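import Mathlib
import HarnessLib
import Summits.HubbardSuperconductivity.HubbardSuperconductivity.Theorems.KLProgrammeKLRegimeEngineWtBudget

/-!
# Route `KLProgramme` — crux K3, VL child `KLRegimeVolumeLimitV17F2` (stmt-HubbardSuperconductivity-20440), skeleton «cauchy» v11: THE E1 DEGREE LAW AS A
# GEOMETRIC MAJORANT (assembler kit for (H3) via `…TowerSmallnessGeom.towerSmallness_of_geom`; seat hubbard-kl-k3c4-p1 g15; `--supports` 20440)

`towerSmallness_of_geom` consumes the profile budgets in the shape `NV j m ≤ A j · q j ^ m` (geometric in the half-degree `m`).  E1's law (and, under cure (β),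
the rescaled source families' law, `…TowerSrcScaleChoice`) is `klWtBudget P Q U n (2m) = CE^m · ε_n^{max(1,m−1)} · 2^{(3m−5)n}`: `CE·ε_n·4^{−n}` in degree 2,
`CE²·ε_n·2^{n}` in degree 4, ratio `CE·ε_n·8^n` per further half-degree.  It is NOT geometric with a small ratio between degrees 2 and 4, but it IS dominated by a
geometric majorant at ANY ratio `q ≥ CE·ε_n·8^n` with a constant of size `32^{−n}·(ρ + ρ²/ε_n)`, `ρ = CE·ε_n·8^n/q` — and the radii of the two-volume step
make `q = 1/(2(e²(κ_n+ρ₀))²) ≍ 8^n`, i.e. `ρ ≍ ε_n`, so the constant is `O(ε_n·32^{−n})` (DISCHARGER-GUIDE-g14 §2, bus 07:51Z «cW-BUDGET»):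

* **`klWtBudget_two_mul_le_geom`** — `klWtBudget P Q U n (2m) ≤ 32^{−n}·(ρ + ε_n⁻¹·ρ²)·q^m` for `m ≥ 1`, `q ≥ CE·ε_n·8^n`, `q > 0`, `ε_n > 0`;
* `klWtBudget_two_le_geom_one` (degree 2 alone: `≤ 32^{−n}·ρ·q`);
* **`towerBudget_le_geom`** — the v11 budget `S₀ j (2m) + τ_j·(if 2m ≤ 2 then 1 else klWtBudget P Q′ U n (2m))` (alive family with E1's law at constant `C₀`,
  rescaled source families from `…TowerSrcScaleChoice`) is `≤ A·q^m`, `A = 32^{−n}C₀(ρ + ρ²/ε_n) + τ/q + τ·32^{−n}(ρ′ + ρ′²/ε_n)` — THE `hNV` INPUT of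
  `towerSmallness_of_geom`.

Proofs only; no definition; elementary. [cite: BenfattoGiulianiMastropietro2006, §2.7 (2.77)-(2.80)]
-/

noncomputable section

namespace Summit.HubbardSuperconductivity.HubbardSuperconductivity.Theorems.TwoVolumeSource

set_option linter.dupNamespace false -- summit = problem name (single-conjunct summit), D-0017

open Summit.HubbardSuperconductivity.HubbardSuperconductivity.Theorems.KLProgrammeLegKernels
open Summit.HubbardSuperconductivity.HubbardSuperconductivity.Theorems.KLRegimeSplit
open Summit.HubbardSuperconductivity.HubbardSuperconductivity.Theorems.EngineV8

/-- `2^{−2n} = 8^n/32^n`. [folklore] -/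
private theorem two_zpow_neg_two_mul (n : ℕ) : (2 : ℝ) ^ (-(2 * (n : ℤ))) = ((32 : ℝ) ^ n)⁻¹ * 8 ^ n := by
  rw [show (-(2 * (n : ℤ))) = -(((2 * n : ℕ) : ℤ)) by push_cast; ring, zpow_neg, zpow_natCast, pow_mul,
    show ((32 : ℝ) ^ n) = (4 : ℝ) ^ n * 8 ^ n by rw [← mul_pow]; norm_num, mul_inv, mul_assoc, inv_mul_cancel₀ (by positivity), mul_one]
  norm_num

/-- `2^{(3(k+2)−5)n} = 8^{kn}·2^n`. [folklore] -/
private theorem two_zpow_three_mul_sub_five (k n : ℕ) : (2 : ℝ) ^ ((3 * ((k + 2 : ℕ) : ℤ) - 5) * n) = (8 : ℝ) ^ (k * n) * 2 ^ n := by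
  rw [show (3 * ((k + 2 : ℕ) : ℤ) - 5) * n = (((3 * k + 1) * n : ℕ) : ℤ) by push_cast; ring, zpow_natCast, add_mul, one_mul, pow_add,
    show (8 : ℝ) = 2 ^ 3 by norm_num, ← pow_mul, mul_assoc]

/-- **Degree 2 alone**: `klWtBudget P Q U n 2 ≤ 32^{−n}·ρ·q`, `ρ = CE·ε_n·8^n/q` (in fact equality). [folklore] -/
theorem klWtBudget_two_le_geom_one (P : SplitConsts) (Q : EngConsts) (U : ℝ) (n : ℕ) {q : ℝ} (hq0 : 0 < q) :
    klWtBudget P Q U n 2 ≤ ((32 : ℝ) ^ n)⁻¹ * (Q.CE * epsCoupling P U n * 8 ^ n / q) * q := by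
  rw [klWtBudget_two, two_zpow_neg_two_mul, mul_assoc ((32 : ℝ) ^ n)⁻¹, div_mul_cancel₀ _ hq0.ne']
  exact le_of_eq (by ring)

/-- **THE E1 DEGREE LAW UNDER A GEOMETRIC MAJORANT** (see the module docstring): for `m ≥ 1`, `q ≥ CE·ε_n·8^n`, `q > 0`, `ε_n > 0`,
`klWtBudget P Q U n (2m) ≤ 32^{−n} · (ρ + ε_n⁻¹·ρ²) · q^m`, `ρ = CE·ε_n·8^n/q`. [cite: BenfattoGiulianiMastropietro2006, §2.7 (2.77)-(2.80)] -/
theorem klWtBudget_two_mul_le_geom (P : SplitConsts) (Q : EngConsts) (U : ℝ) (n : ℕ) (hCE : 0 ≤ Q.CE) (hε : 0 < epsCoupling P U n)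
    {q : ℝ} (hq0 : 0 < q) (hq : Q.CE * epsCoupling P U n * 8 ^ n ≤ q) {m : ℕ} (hm : 1 ≤ m) :
    klWtBudget P Q U n (2 * m) ≤
      ((32 : ℝ) ^ n)⁻¹ * (Q.CE * epsCoupling P U n * 8 ^ n / q + (epsCoupling P U n)⁻¹ * (Q.CE * epsCoupling P U n * 8 ^ n / q) ^ 2) * q ^ m := by
  have hε0 := hε.le
  have hc0 : 0 ≤ Q.CE * epsCoupling P U n * 8 ^ n := by positivity
  have h32 : 0 < ((32 : ℝ) ^ n)⁻¹ := by positivity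
  have hρ0 : 0 ≤ Q.CE * epsCoupling P U n * 8 ^ n / q := div_nonneg hc0 hq0.le
  rcases Nat.lt_or_ge m 2 with hm1 | hm2
  · -- degree 2
    obtain rfl : m = 1 := by omega
    rw [pow_one]
    refine (klWtBudget_two_le_geom_one P Q U n hq0).trans ?_
    have hx : 0 ≤ ((32 : ℝ) ^ n)⁻¹ * ((epsCoupling P U n)⁻¹ * (Q.CE * epsCoupling P U n * 8 ^ n / q) ^ 2) * q := by positivity
    nlinarith [hx]
  · -- degree `2(k+2)`
    obtain ⟨k, rfl⟩ : ∃ k, m = k + 2 := ⟨m - 2, by omega⟩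
    rw [klWtBudget_two_mul_of_two_le P Q U n (by omega : 2 ≤ k + 2), two_zpow_three_mul_sub_five, show k + 2 - 1 = k + 1 from rfl]
    have hqk : (Q.CE * epsCoupling P U n * 8 ^ n) ^ k ≤ q ^ k := pow_le_pow_left₀ hc0 hq k
    -- the right-hand side is at least `32^{-n} ε⁻¹ c^{k+2}`
    have h1 : ((32 : ℝ) ^ n)⁻¹ * ((epsCoupling P U n)⁻¹ * (Q.CE * epsCoupling P U n * 8 ^ n) ^ 2 * (Q.CE * epsCoupling P U n * 8 ^ n) ^ k) ≤
        ((32 : ℝ) ^ n)⁻¹ * ((epsCoupling P U n)⁻¹ * (Q.CE * epsCoupling P U n * 8 ^ n) ^ 2 * q ^ k) :=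
      mul_le_mul_of_nonneg_left (mul_le_mul_of_nonneg_left hqk (by positivity)) h32.le
    have h2 : ((32 : ℝ) ^ n)⁻¹ * ((epsCoupling P U n)⁻¹ * (Q.CE * epsCoupling P U n * 8 ^ n) ^ 2 * q ^ k) =
        ((32 : ℝ) ^ n)⁻¹ * ((epsCoupling P U n)⁻¹ * (Q.CE * epsCoupling P U n * 8 ^ n / q) ^ 2) * q ^ (k + 2) := by
      rw [div_pow, pow_add]
      field_simp
    have h3 : ((32 : ℝ) ^ n)⁻¹ * ((epsCoupling P U n)⁻¹ * (Q.CE * epsCoupling P U n * 8 ^ n / q) ^ 2) * q ^ (k + 2) ≤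
        ((32 : ℝ) ^ n)⁻¹ * (Q.CE * epsCoupling P U n * 8 ^ n / q + (epsCoupling P U n)⁻¹ * (Q.CE * epsCoupling P U n * 8 ^ n / q) ^ 2) * q ^ (k + 2) := by
      have : 0 ≤ ((32 : ℝ) ^ n)⁻¹ * (Q.CE * epsCoupling P U n * 8 ^ n / q) * q ^ (k + 2) := by positivity
      nlinarith [this]
    refine le_trans (le_of_eq ?_) (h1.trans (h2.le.trans h3))
    -- the identity `CE^{k+2} ε^{k+1} 8^{kn} 2^n = 32^{-n} ε⁻¹ c^{k+2}`
    have hεne : epsCoupling P U n ≠ 0 := hε.ne'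
    rw [show (32 : ℝ) = 2 ^ 5 by norm_num, show (8 : ℝ) = 2 ^ 3 by norm_num]
    simp only [← pow_mul, mul_pow]
    field_simp
    ring

/-- **THE v11 PROFILE BUDGET UNDER ONE GEOMETRIC MAJORANT** (alive family with E1's law at constant `C₀`, the two rescaled source families below
`τ·(Q′-law)` as delivered by `…TowerSrcScaleChoice`): for `m ≥ 1` and any `q ≥ max(CE, CE′)·ε_n·8^n`,
`S₀ (2m) + τ·(if 2m ≤ 2 then 1 else klWtBudget P Q′ U n (2m)) ≤ A·q^m` with
`A = 32^{−n}·C₀·(ρ + ε_n⁻¹ρ²) + τ/q + τ·32^{−n}·(ρ′ + ε_n⁻¹ρ′²)`, `ρ = CE·ε_n·8^n/q`, `ρ′ = CE′·ε_n·8^n/q` — the `hNV` input of `towerSmallness_of_geom`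
at scale `j = n − 1` (degree `0` is budget-free: set `NV j 0 := 0`). [cite: BenfattoGiulianiMastropietro2006, §2.7 (2.77)-(2.80), §2.9 (4.6)-(4.8)] -/
theorem towerBudget_le_geom (P : SplitConsts) (Q Q' : EngConsts) (U : ℝ) (n : ℕ) (hCE : 0 ≤ Q.CE) (hCE' : 0 ≤ Q'.CE) (hε : 0 < epsCoupling P U n)
    {q : ℝ} (hq0 : 0 < q) (hq : Q.CE * epsCoupling P U n * 8 ^ n ≤ q) (hq' : Q'.CE * epsCoupling P U n * 8 ^ n ≤ q)
    {C₀ τ : ℝ} (hC₀ : 0 ≤ C₀) (hτ : 0 ≤ τ) (S₀ : ℕ → ℝ) (hS₀ : ∀ m, 1 ≤ m → S₀ (2 * m) ≤ C₀ * klWtBudget P Q U n (2 * m)) {m : ℕ} (hm : 1 ≤ m) :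
    S₀ (2 * m) + τ * (if 2 * m ≤ 2 then 1 else klWtBudget P Q' U n (2 * m)) ≤
      (((32 : ℝ) ^ n)⁻¹ * C₀ * (Q.CE * epsCoupling P U n * 8 ^ n / q + (epsCoupling P U n)⁻¹ * (Q.CE * epsCoupling P U n * 8 ^ n / q) ^ 2) + τ / q +
        τ * (((32 : ℝ) ^ n)⁻¹ * (Q'.CE * epsCoupling P U n * 8 ^ n / q + (epsCoupling P U n)⁻¹ * (Q'.CE * epsCoupling P U n * 8 ^ n / q) ^ 2))) * q ^ m := by
  have hε0 := hε.le
  have hqm : 0 < q ^ m := pow_pos hq0 m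
  -- the three nonnegative pieces of `A`
  have hA₁ : 0 ≤ ((32 : ℝ) ^ n)⁻¹ * C₀ * (Q.CE * epsCoupling P U n * 8 ^ n / q + (epsCoupling P U n)⁻¹ * (Q.CE * epsCoupling P U n * 8 ^ n / q) ^ 2) := by
    positivity
  have hA₂ : 0 ≤ τ / q := div_nonneg hτ hq0.le
  have hA₃ : 0 ≤ τ * (((32 : ℝ) ^ n)⁻¹ * (Q'.CE * epsCoupling P U n * 8 ^ n / q + (epsCoupling P U n)⁻¹ * (Q'.CE * epsCoupling P U n * 8 ^ n / q) ^ 2)) := by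
    positivity
  -- the alive piece
  have h₀ : S₀ (2 * m) ≤ ((32 : ℝ) ^ n)⁻¹ * C₀ * (Q.CE * epsCoupling P U n * 8 ^ n / q + (epsCoupling P U n)⁻¹ * (Q.CE * epsCoupling P U n * 8 ^ n / q) ^ 2) * q ^ m := by
    refine (hS₀ m hm).trans ?_
    have h := mul_le_mul_of_nonneg_left (klWtBudget_two_mul_le_geom P Q U n hCE hε hq0 hq hm) hC₀
    refine h.trans (le_of_eq ?_)
    ring
  -- the source piece
  have h₁ : τ * (if 2 * m ≤ 2 then 1 else klWtBudget P Q' U n (2 * m)) ≤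
      (τ / q + τ * (((32 : ℝ) ^ n)⁻¹ * (Q'.CE * epsCoupling P U n * 8 ^ n / q + (epsCoupling P U n)⁻¹ * (Q'.CE * epsCoupling P U n * 8 ^ n / q) ^ 2))) * q ^ m := by
    split_ifs with h2
    · obtain rfl : m = 1 := by omega
      rw [mul_one, pow_one, add_mul, div_mul_cancel₀ _ hq0.ne']
      exact le_add_of_nonneg_right (mul_nonneg hA₃ hq0.le)
    · have h := mul_le_mul_of_nonneg_left (klWtBudget_two_mul_le_geom P Q' U n hCE' hε hq0 hq' hm) hτ
      rw [add_mul]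
      refine h.trans ?_
      rw [← mul_assoc]
      exact le_add_of_nonneg_left (mul_nonneg hA₂ hqm.le)
  calc S₀ (2 * m) + τ * (if 2 * m ≤ 2 then 1 else klWtBudget P Q' U n (2 * m))
      ≤ ((32 : ℝ) ^ n)⁻¹ * C₀ * (Q.CE * epsCoupling P U n * 8 ^ n / q + (epsCoupling P U n)⁻¹ * (Q.CE * epsCoupling P U n * 8 ^ n / q) ^ 2) * q ^ m +
        (τ / q + τ * (((32 : ℝ) ^ n)⁻¹ * (Q'.CE * epsCoupling P U n * 8 ^ n / q + (epsCoupling P U n)⁻¹ * (Q'.CE * epsCoupling P U n * 8 ^ n / q) ^ 2))) * q ^ m :=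
        add_le_add h₀ h₁
    _ = _ := by ring

end Summit.HubbardSuperconductivity.HubbardSuperconductivity.Theorems.TwoVolumeSource

end
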